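import Literature.AlgebraicGeometry.Frobenioids.ModelFrobenioidWalkingArrow
import Literature.AlgebraicGeometry.Frobenioids.Thm34ivvOverFSMFF2024
import HarnessLib

/-!
# Frobenioids I, Thm. 3.4 (iv)/(v) at the Frobenioid over the walking arrow: the base is slim, so the
# FSMFF-2024 closers of (iv) and (v) are inhabited there too (non-vacuity beyond FSM-type bases)

Mochizuki, *The geometry of Frobenioids I: the general theory*, Kyushu J. Math. **62** (2008), §0 p. 14
("rigid", "slim"), Def. 3.1 (i) p. 56 ("every slim category is Frobenius-slim"), Thm. 3.4 (iv)/(v) pp. 62–63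
[cite: MochizukiFrdI2008, Thm. 3.4 (iv) p.63]; condition (b) of "FSMFF-type" as revised in the author's
*Comments* (January 2024), item (28) [cite: MochizukiFrdIComments2024, (28) p.3].

PROOF-ONLY file (seat abc-iut-w4-d088; companion of `ModelFrobenioidWalkingArrow.lean`, downstream of GAP-LEDGER
row G-L1d8-1): a functor into a thin category is rigid (`isRigidFunctor_of_isThin`), so the walking arrow `Fin 2`
is slim (`isSlim_fin2`) and Frobenius-slim; hence for the model Frobenioid of `(Fin 2, ℕ, 0, Div_B)` — a
Frobenioid of standard type over a base of FSMFF-type (revised) that is NOT of FSM-type — the CONCLUSIONS of the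
typed Thm. 3.4 (iv) (`Ψ` preserves `O^▷(−)`, `O^×(−)`, Frobenius degrees) and (v) (base-identity endomorphisms,
base-equivalent pairs, the `1`-unique rigid `Ψ^Base`) hold for every self-equivalence `Ψ`, ALL antecedents of
`FrdI.thm34iv/v_ofFunctor_of_isOfFSMFFType2024` being discharged (`thm34iv/v_conclusion_walkingArrow`).
No new definition; no statement of the paper is strengthened.
-/

noncomputable section

namespace Literature.AlgebraicGeometry.Frobenioids

open CategoryTheory Opposite

/-- A functor into a thin category is rigid (every natural automorphism is the identity: its components live
in one-element hom-sets). [cite: MochizukiFrdI2008, §0 p.14] -/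
theorem isRigidFunctor_of_isThin {C₁ : Type*} [Category C₁] {C₂ : Type*} [Category C₂] [Quiver.IsThin C₂]
    (φ : C₁ ⥤ C₂) : IsRigidFunctor φ := fun α => by
  ext X
  exact Subsingleton.elim _ _

namespace ConstNatModel

/-- **The walking arrow is slim** (a thin category: all slice-forgetful functors are rigid).
[cite: MochizukiFrdI2008, §0 p.14] -/
theorem isSlim_fin2 : IsSlim (Fin 2) := ⟨fun _ => isRigidFunctor_of_isThin _⟩

/-- … hence Frobenius-slim (Def. 3.1 (i)). [cite: MochizukiFrdI2008, Def. 3.1 (i) p.56] -/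
theorem isFrobeniusSlim_fin2 : IsFrobeniusSlim (Fin 2) := isSlim_fin2.isFrobeniusSlim

variable (DivB : zeroMonoid.{0} (Fin 2) ⟶ monoidGp ((Functor.const (Fin 2)ᵒᵖ).obj (CommMonCat.of DegreeModel.N)))

/-- **Non-vacuity of [FrdI] Thm. 3.4 (iv) (preservation part) over FSMFF-2024 bases at Frobenioid level**: for
the Frobenioid over the walking arrow (NOT of FSM-type) and any self-equivalence `Ψ`, the CONCLUSION of the typed
`Thm34iv` — `Ψ` preserves `O^▷(−)`, `O^×(−)` and Frobenius degrees — holds, all antecedents ((a) standard type,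
(b) `HypB`, (c) Frobenius-slim bases) being discharged. [cite: MochizukiFrdI2008, Thm. 3.4 (iv) p.63]
[cite: MochizukiFrdIComments2024, (28) p.3] -/
theorem thm34iv_conclusion_walkingArrow (Ψ : ModelFrobenioid _ _ DivB ≌ ModelFrobenioid _ _ DivB) :
    (∀ (A : ModelFrobenioid _ _ DivB) (α : End A), α ∈ (ModelFrobenioid.data _ _ DivB).endSubmonoid A →
        Ψ.functor.map α ∈ (ModelFrobenioid.data _ _ DivB).endSubmonoid (Ψ.functor.obj A)) ∧
      (∀ (A : ModelFrobenioid _ _ DivB) (α : Aut A), α ∈ (ModelFrobenioid.data _ _ DivB).unitsSubgroup A →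
        Ψ.functor.mapIso α ∈ (ModelFrobenioid.data _ _ DivB).unitsSubgroup (Ψ.functor.obj A)) ∧
      PreFrobenioidData.PreservesDegFr (ModelFrobenioid.data _ _ DivB) (ModelFrobenioid.data _ _ DivB) Ψ :=
  FrdI.thm34iv_ofFunctor_of_isOfFSMFFType2024 (isFrobenioid_walkingArrow DivB) (isFrobenioid_walkingArrow DivB)
    WalkingArrow.isOfFSMFFType2024 WalkingArrow.isOfFSMFFType2024 Ψ (isOfStandardType_walkingArrow DivB)
    (isOfStandardType_walkingArrow DivB) (hypB_walkingArrow DivB Ψ) isFrobeniusSlim_fin2 isFrobeniusSlim_fin2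

/-- **Non-vacuity of [FrdI] Thm. 3.4 (v) over FSMFF-2024 bases at Frobenioid level**: for the Frobenioid over
the walking arrow and any self-equivalence `Ψ`, the CONCLUSION of the typed `Thm34v` — base-identity endomorphisms
and base-equivalent pairs preserved, a `1`-unique `Ψ^Base : Fin 2 ⥤ Fin 2` `1`-commuting with `Ψ` over the base
functors, both composites rigid — holds, all antecedents ((a), (b), (c) slim bases) being discharged.
[cite: MochizukiFrdI2008, Thm. 3.4 (v) p.63] [cite: MochizukiFrdIComments2024, (28) p.3] -/
theorem thm34v_conclusion_walkingArrow (Ψ : ModelFrobenioid _ _ DivB ≌ ModelFrobenioid _ _ DivB) :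
    (∀ (A : ModelFrobenioid _ _ DivB) (α : A ⟶ A), (ModelFrobenioid.data _ _ DivB).IsBaseIdentity α →
        (ModelFrobenioid.data _ _ DivB).IsBaseIdentity (Ψ.functor.map α)) ∧
      PreFrobenioidData.PreservesRel Ψ.functor
        (fun ⦃_ _⦄ φ ψ => (ModelFrobenioid.data _ _ DivB).BaseEquivalent φ ψ)
        (fun ⦃_ _⦄ φ ψ => (ModelFrobenioid.data _ _ DivB).BaseEquivalent φ ψ) ∧
      ∃ ΨBase : Fin 2 ⥤ Fin 2,
        PreFrobenioidData.OneUniqueSquare Ψ.functor (ModelFrobenioid.data _ _ DivB).base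
          (ModelFrobenioid.data _ _ DivB).base ΨBase ∧
        IsRigidFunctor (Ψ.functor ⋙ (ModelFrobenioid.data _ _ DivB).base) ∧
        IsRigidFunctor ((ModelFrobenioid.data _ _ DivB).base ⋙ ΨBase) :=
  FrdI.thm34v_ofFunctor_of_isOfFSMFFType2024 (isFrobenioid_walkingArrow DivB) (isFrobenioid_walkingArrow DivB)
    WalkingArrow.isOfFSMFFType2024 WalkingArrow.isOfFSMFFType2024 Ψ (isOfStandardType_walkingArrow DivB)
    (isOfStandardType_walkingArrow DivB) (hypB_walkingArrow DivB Ψ) isSlim_fin2 isSlim_fin2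

end ConstNatModel

end Literature.AlgebraicGeometry.Frobenioids
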